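import Summits.Ventures.LatticeQCDFlow.Scoring.SchwingerDysonPhi4Gibbs
import HarnessLib

/-!
# The lattice φ⁴ Schwinger–Dyson identity for every monomial observable under a coercive Gibbs measure

HONEST FRAMING: exact (Metropolis-corrected) sampling algorithms for lattice gauge theory;
figures of merit are autocorrelation/cost numbers at stated couplings and volumes; no
continuum-physics claim.  (SCALAR calibration rung S0-A: not a gauge result.)

Venture `LatticeQCDFlow` (cell pub-lqcd), sub-topic `Scoring`; FANOUT row 2 (`s0-phi4`).  NEW WORK
of the cell (our own statement and proof).  Fourth file of the φ⁴ Schwinger–Dyson series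
(`SchwingerDysonPhi4.lean`: one-variable tower; `SchwingerDysonPhi4Lattice.lean`: lattice algebra;
`SchwingerDysonPhi4Gibbs.lean`: the Gibbs virial identity `⟨φ_x ∂S/∂φ_x⟩ = 1`, whose docstring
lists "higher members of the tower (same proof, `n ≥ 2`)" as NOT there).  This file proves the
integration-by-parts identity `⟨f ∂S/∂φ_x⟩ = ⟨∂f/∂φ_x⟩` for EVERY MONOMIAL `f` under the JOINT
Gibbs law — hence, by linearity, for every polynomial observable; the named corollaries
(equation of motion, tower, propagator equation, score identity, the Gaussian free-field
oracle) are read off in the companion file `SchwingerDysonPhi4GibbsPolynomial.lean`.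

Setting: sites `Λ = Fin (n+1)`, configurations `φ : Λ → ℝ`, ANY real coupling matrix `J` and
ANY real `λ`, `S(φ) = Σ_{x,y} φ_x J_{xy} φ_y + λ Σ_x φ_x⁴` (`latticePhi4Action`), `F_x = ∂S/∂φ_x`
(`latticePhi4Force`), `⟨g⟩ = (1/Z) ∫ g e^{−S} dφ` (`gibbsExpect`).  The ONLY analytic input is
COERCIVITY: `ε Σ_w φ_w² − K ≤ S(φ)` for some `ε > 0`, `K` — discharged here for `λ > 0` and any
`J` (`latticePhi4Action_coercive`, the companion file's `latticePhi4Action_ge`), and in the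
companion file for `λ ≥ 0` with positive-definite symmetric part of `J` (the Gaussian case).

**Theorem (`gibbs_sd_monomial_of_coercive`; `gibbs_sd_monomial` for `λ > 0`).**  For every
multi-index `k : Λ → ℕ` and every site `x`,

  `⟨(Π_w φ_w^{k_w}) · ∂S/∂φ_x⟩ = k_x · ⟨Π_w φ_w^{k[x ↦ k_x − 1]_w}⟩`.

**Proof.**  Integrability (`integrable_monomial_mul_gibbsWeight_of_coercive`):
`|Π_w φ_w^{k_w}| e^{−S} ≤ e^{K} Π_w |φ_w|^{k_w} e^{−εφ_w²}` and the site-dependent product is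
integrable (`Integrable.fintype_prod`, Gaussian moments); `(Π φ^k) F_x` is a finite combination
of monomials (`prod_pow_mul_latticePhi4Force`).  Identity: Fubini along the `x`-th coordinate
(`MeasurableEquiv.piFinSuccAbove`, volume preserving) as in `integral_virialIntegrand_eq_zero`;
on the coordinate line the monomial is `t^{k_x}` times a constant, the action is the quartic site
potential (`latticePhi4Action_update`) — which INHERITS the quadratic lower bound
(`sitePotential_coercive_of_coercive`) — and the force is its derivative (`latticePhi4Force_eq`),
so the inner integral is the constant times the one-variable tower `integral_phi4Site_sd_pow` at
exponent `k_x`, zero for EVERY frozen exterior.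

Classical origin (our formalisation on the finite lattice with Lebesgue reference measure and an
explicit coercivity hypothesis; not a tree fact): the integration-by-parts identity for `P(φ)`
measures, Glimm–Jaffe, *Quantum Physics* (2nd ed., 1987), eq. (8.4.2) / (9.1.32), §12.2.

NOT here: non-polynomial observables; any statement about the statistical POWER of the resulting
columns (a canary, under the numerics gate).
-/

namespace Summit.Ventures.LatticeQCDFlow.Scoring

open Real MeasureTheory Set Filter Finset

section Monomial

variable {n : ℕ}

/-! ## Monomial bookkeeping -/

/-- Splitting a monomial at a site: `Π_w φ_w^{k_w} = φ_y^{k_y} · Π_{w ≠ y} φ_w^{k_w}`. -/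
theorem prod_pow_eq_mul_prod_erase (φ : Fin (n + 1) → ℝ) (k : Fin (n + 1) → ℕ)
    (y : Fin (n + 1)) :
    ∏ w, φ w ^ k w = φ y ^ k y * ∏ w ∈ univ.erase y, φ w ^ k w :=
  (Finset.mul_prod_erase univ (fun w => φ w ^ k w) (mem_univ y)).symm

/-- A monomial with the exponent at `y` replaced by `j`:
`Π_w φ_w^{k[y ↦ j]_w} = φ_y^j · Π_{w ≠ y} φ_w^{k_w}`. -/
theorem prod_pow_update (φ : Fin (n + 1) → ℝ) (k : Fin (n + 1) → ℕ) (y : Fin (n + 1))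
    (j : ℕ) :
    ∏ w, φ w ^ Function.update k y j w = φ y ^ j * ∏ w ∈ univ.erase y, φ w ^ k w := by
  rw [prod_pow_eq_mul_prod_erase φ (Function.update k y j) y, Function.update_self]
  congr 1
  exact Finset.prod_congr rfl fun w hw => by rw [Function.update_of_ne (ne_of_mem_erase hw)]

/-- Multiplying a monomial by a power of one coordinate raises that exponent:
`(Π_w φ_w^{k_w}) φ_y^j = Π_w φ_w^{k[y ↦ k_y + j]_w}`. -/
theorem prod_pow_mul_pow (φ : Fin (n + 1) → ℝ) (k : Fin (n + 1) → ℕ) (y : Fin (n + 1))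
    (j : ℕ) :
    (∏ w, φ w ^ k w) * φ y ^ j = ∏ w, φ w ^ Function.update k y (k y + j) w := by
  rw [prod_pow_update, prod_pow_eq_mul_prod_erase φ k y, pow_add]
  ring

/-- The monomial along the `x`-th coordinate line:
`Π_w (ψ[x ↦ t])_w^{k_w} = t^{k_x} · Π_{w ≠ x} ψ_w^{k_w}`. -/
theorem prod_update_pow (ψ : Fin (n + 1) → ℝ) (x : Fin (n + 1)) (t : ℝ)
    (k : Fin (n + 1) → ℕ) :
    ∏ w, Function.update ψ x t w ^ k w = t ^ k x * ∏ w ∈ univ.erase x, ψ w ^ k w := by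
  rw [prod_pow_eq_mul_prod_erase _ k x, Function.update_self]
  congr 1
  exact Finset.prod_congr rfl fun w hw => by rw [Function.update_of_ne (ne_of_mem_erase hw)]

/-- A single power is the monomial `k = m·δ_x`: `Π_w φ_w^{(0[x ↦ m])_w} = φ_x^m`. -/
theorem prod_pow_single (φ : Fin (n + 1) → ℝ) (x : Fin (n + 1)) (m : ℕ) :
    ∏ w, φ w ^ Function.update (fun _ => (0 : ℕ)) x m w = φ x ^ m := by
  rw [prod_pow_update]
  simp

/-- A product of two powers is the monomial `k = a·δ_x + b·δ_y` (also when `x = y`). -/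
theorem prod_pow_pair (φ : Fin (n + 1) → ℝ) (x y : Fin (n + 1)) (a b : ℕ) :
    ∏ w, φ w ^ Function.update (Function.update (fun _ => (0 : ℕ)) x a) y
        (Function.update (fun _ => (0 : ℕ)) x a y + b) w
      = φ x ^ a * φ y ^ b := by
  rw [← prod_pow_mul_pow, prod_pow_single]

/-- **Expansion of `monomial × force` into monomials**:
`(Π φ^k) F_x = Σ_y (J_{xy} + J_{yx}) Π φ^{k[y ↦ k_y+1]} + 4λ Π φ^{k[x ↦ k_x+3]}`. -/
theorem prod_pow_mul_latticePhi4Force (J : Fin (n + 1) → Fin (n + 1) → ℝ) (lam : ℝ)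
    (φ : Fin (n + 1) → ℝ) (k : Fin (n + 1) → ℕ) (x : Fin (n + 1)) :
    (∏ w, φ w ^ k w) * latticePhi4Force J lam φ x
      = (∑ y, (J x y + J y x) * ∏ w, φ w ^ Function.update k y (k y + 1) w)
        + 4 * lam * ∏ w, φ w ^ Function.update k x (k x + 3) w := by
  unfold latticePhi4Force
  rw [mul_add, Finset.mul_sum]
  congr 1
  · refine Finset.sum_congr rfl fun y _ => ?_
    rw [← prod_pow_mul_pow φ k y 1, pow_one]
    ring
  · rw [← prod_pow_mul_pow φ k x 3]
    ring

/-! ## Coercive actions: every monomial density is integrable -/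

/-- The site-dependent product dominator `Π_w |φ_w|^{k_w} e^{−ε φ_w²}` is integrable on
`ℝ^{n+1}` (`ε > 0`; Gaussian moments per coordinate, `Integrable.fintype_prod`). -/
theorem integrable_prod_abs_pow_gaussian {ε : ℝ} (hε : 0 < ε) (k : Fin (n + 1) → ℕ) :
    Integrable (fun φ : Fin (n + 1) → ℝ => ∏ w, (|φ w| ^ k w * Real.exp (-ε * φ w ^ 2))) := by
  have h1 : ∀ w : Fin (n + 1), Integrable (fun t : ℝ => |t| ^ k w * Real.exp (-ε * t ^ 2)) := by
    intro w
    refine ((integrable_pow_mul_gaussian hε (k w)).norm).congr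
      (Eventually.of_forall fun t => ?_)
    dsimp only
    rw [norm_mul, Real.norm_eq_abs, Real.norm_eq_abs, abs_pow, abs_of_pos (Real.exp_pos _)]
  have h := Integrable.fintype_prod (ι := Fin (n + 1))
    (f := fun w (t : ℝ) => |t| ^ k w * Real.exp (-ε * t ^ 2)) (μ := fun _ => volume) h1
  simpa [MeasureTheory.volume_pi] using h

/-- Continuity of a monomial. -/
theorem continuous_prod_pow (k : Fin (n + 1) → ℕ) :
    Continuous (fun φ : Fin (n + 1) → ℝ => ∏ w, φ w ^ k w) :=
  continuous_finsetProd _ fun w _ => (continuous_apply w).pow _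

/-- **Coercivity ⇒ Gaussian domination of the Gibbs density**:
`ε Σ_w φ_w² − K ≤ S(φ)` for all `φ` gives `e^{−S(φ)} ≤ e^{K} Π_w e^{−ε φ_w²}`. -/
theorem gibbsWeight_le_of_coercive {J : Fin (n + 1) → Fin (n + 1) → ℝ} {lam ε K : ℝ}
    (hS : ∀ φ : Fin (n + 1) → ℝ, ε * ∑ w, φ w ^ 2 - K ≤ latticePhi4Action J lam φ)
    (φ : Fin (n + 1) → ℝ) :
    gibbsWeight J lam φ ≤ Real.exp K * ∏ w, Real.exp (-ε * φ w ^ 2) := by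
  rw [gibbsWeight, ← Real.exp_sum, ← Real.exp_add]
  apply Real.exp_le_exp.mpr
  have h := hS φ
  have e : ∑ w, -ε * φ w ^ 2 = -(ε * ∑ w, φ w ^ 2) := by
    rw [Finset.mul_sum, ← Finset.sum_neg_distrib]
    exact Finset.sum_congr rfl fun w _ => by ring
  linarith

/-- **Every monomial density `(Π_w φ_w^{k_w}) e^{−S(φ)}` is integrable on `ℝ^{n+1}`** under
coercivity: all moments of the Gibbs measure exist. -/
theorem integrable_monomial_mul_gibbsWeight_of_coercive {J : Fin (n + 1) → Fin (n + 1) → ℝ}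
    {lam ε K : ℝ} (hε : 0 < ε)
    (hS : ∀ φ : Fin (n + 1) → ℝ, ε * ∑ w, φ w ^ 2 - K ≤ latticePhi4Action J lam φ)
    (k : Fin (n + 1) → ℕ) :
    Integrable (fun φ : Fin (n + 1) → ℝ => (∏ w, φ w ^ k w) * gibbsWeight J lam φ) := by
  refine Integrable.mono' ((integrable_prod_abs_pow_gaussian hε k).const_mul (Real.exp K))
    (((continuous_prod_pow k).mul (continuous_gibbsWeight J lam)).aestronglyMeasurable)
    (Eventually.of_forall fun φ => ?_)
  rw [Real.norm_eq_abs, abs_mul, abs_of_pos (gibbsWeight_pos J lam φ), Finset.abs_prod]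
  have hw := gibbsWeight_le_of_coercive hS φ
  have hP0 : 0 ≤ ∏ w, |φ w ^ k w| := Finset.prod_nonneg fun w _ => abs_nonneg _
  calc (∏ w, |φ w ^ k w|) * gibbsWeight J lam φ
      ≤ (∏ w, |φ w ^ k w|) * (Real.exp K * ∏ w, Real.exp (-ε * φ w ^ 2)) :=
        mul_le_mul_of_nonneg_left hw hP0
    _ = Real.exp K * ∏ w, (|φ w| ^ k w * Real.exp (-ε * φ w ^ 2)) := by
        rw [Finset.prod_mul_distrib]
        simp only [abs_pow]
        ring

/-- The Gibbs density itself is integrable under coercivity (`k = 0`). -/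
theorem integrable_gibbsWeight_of_coercive {J : Fin (n + 1) → Fin (n + 1) → ℝ} {lam ε K : ℝ}
    (hε : 0 < ε) (hS : ∀ φ : Fin (n + 1) → ℝ, ε * ∑ w, φ w ^ 2 - K ≤ latticePhi4Action J lam φ) :
    Integrable (gibbsWeight J lam) := by
  simpa using integrable_monomial_mul_gibbsWeight_of_coercive hε hS (fun _ => 0)

/-- `Z > 0` under coercivity. -/
theorem gibbsZ_pos_of_coercive {J : Fin (n + 1) → Fin (n + 1) → ℝ} {lam ε K : ℝ}
    (hε : 0 < ε) (hS : ∀ φ : Fin (n + 1) → ℝ, ε * ∑ w, φ w ^ 2 - K ≤ latticePhi4Action J lam φ) :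
    0 < gibbsZ J lam := by
  unfold gibbsZ
  have h := integrable_gibbsWeight_of_coercive hε hS
  unfold gibbsWeight at h ⊢
  exact integral_exp_pos h

/-- Integrability of `φ_x^a φ_y^b e^{−S}` under coercivity (covers `φ_x^m`, `φ_z φ_y`, `φ_x³ φ_y`). -/
theorem integrable_pow_mul_pow_mul_gibbsWeight_of_coercive {J : Fin (n + 1) → Fin (n + 1) → ℝ}
    {lam ε K : ℝ} (hε : 0 < ε)
    (hS : ∀ φ : Fin (n + 1) → ℝ, ε * ∑ w, φ w ^ 2 - K ≤ latticePhi4Action J lam φ)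
    (x y : Fin (n + 1)) (a b : ℕ) :
    Integrable (fun φ : Fin (n + 1) → ℝ => φ x ^ a * φ y ^ b * gibbsWeight J lam φ) := by
  refine (integrable_monomial_mul_gibbsWeight_of_coercive hε hS
    (Function.update (Function.update (fun _ => (0 : ℕ)) x a) y
      (Function.update (fun _ => (0 : ℕ)) x a y + b))).congr (Eventually.of_forall fun φ => ?_)
  simp only [prod_pow_pair]

/-- **`(Π φ^k) F_x e^{−S}` is integrable** under coercivity: the observable side of the
Schwinger–Dyson identity. -/
theorem integrable_monomial_mul_force_mul_gibbsWeight_of_coercive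
    {J : Fin (n + 1) → Fin (n + 1) → ℝ} {lam ε K : ℝ} (hε : 0 < ε)
    (hS : ∀ φ : Fin (n + 1) → ℝ, ε * ∑ w, φ w ^ 2 - K ≤ latticePhi4Action J lam φ)
    (k : Fin (n + 1) → ℕ) (x : Fin (n + 1)) :
    Integrable (fun φ : Fin (n + 1) → ℝ =>
      (∏ w, φ w ^ k w) * latticePhi4Force J lam φ x * gibbsWeight J lam φ) := by
  have hI := fun k' => integrable_monomial_mul_gibbsWeight_of_coercive hε hS k'
  have h2 := integrable_finsetSum Finset.univ
    (fun y (_ : y ∈ (Finset.univ : Finset (Fin (n + 1)))) =>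
      (hI (Function.update k y (k y + 1))).const_mul (J x y + J y x))
  have h3 := (hI (Function.update k x (k x + 3))).const_mul (4 * lam)
  refine (h2.add h3).congr (Eventually.of_forall fun φ => ?_)
  simp only [Pi.add_apply]
  rw [prod_pow_mul_latticePhi4Force, add_mul, Finset.sum_mul]
  congr 1
  · exact Finset.sum_congr rfl fun y _ => by ring
  · ring

/-- Integrability of `φ_x^a φ_y^b F_z e^{−S}` under coercivity (covers `φ_y F_x`, `φ_x^m F_x`). -/
theorem integrable_pow_mul_pow_mul_force_mul_gibbsWeight_of_coercive
    {J : Fin (n + 1) → Fin (n + 1) → ℝ} {lam ε K : ℝ} (hε : 0 < ε)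
    (hS : ∀ φ : Fin (n + 1) → ℝ, ε * ∑ w, φ w ^ 2 - K ≤ latticePhi4Action J lam φ)
    (x y z : Fin (n + 1)) (a b : ℕ) :
    Integrable (fun φ : Fin (n + 1) → ℝ =>
      φ x ^ a * φ y ^ b * latticePhi4Force J lam φ z * gibbsWeight J lam φ) := by
  refine (integrable_monomial_mul_force_mul_gibbsWeight_of_coercive hε hS
    (Function.update (Function.update (fun _ => (0 : ℕ)) x a) y
      (Function.update (fun _ => (0 : ℕ)) x a y + b)) z).congr (Eventually.of_forall fun φ => ?_)
  simp only [prod_pow_pair]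

/-! ## The Schwinger–Dyson identity -/

/-- **Coercivity restricted to a coordinate line.**  If `ε Σφ² − K ≤ S` globally and `ψ_x = 0`,
the quartic site potential `t ↦ S(ψ[x ↦ t]) = λt⁴ + J_{xx}t² + b_x t + S(ψ)`
(`latticePhi4Action_update`) satisfies `ε t² − K ≤ V(t)` — the hypothesis of the one-variable
tower `integral_phi4Site_sd_pow`, for EVERY frozen exterior, with no sign condition on `J_{xx}`. -/
theorem sitePotential_coercive_of_coercive {J : Fin (n + 1) → Fin (n + 1) → ℝ} {lam ε K : ℝ}
    (hε : 0 < ε) (hS : ∀ φ : Fin (n + 1) → ℝ, ε * ∑ w, φ w ^ 2 - K ≤ latticePhi4Action J lam φ)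
    (ψ : Fin (n + 1) → ℝ) (x : Fin (n + 1)) (hψx : ψ x = 0) (t : ℝ) :
    ε * t ^ 2 - K
      ≤ phi4SitePotential lam (J x x) (∑ y, (J x y + J y x) * ψ y) (latticePhi4Action J lam ψ) t := by
  have hupd0 : Function.update ψ x 0 = ψ := by
    have h := Function.update_eq_self x ψ
    rwa [hψx] at h
  have h := hS (Function.update ψ x t)
  rw [latticePhi4Action_update, hupd0] at h
  have ht : t ^ 2 ≤ ∑ w, Function.update ψ x t w ^ 2 := by
    have h1 := Finset.single_le_sum (f := fun w => Function.update ψ x t w ^ 2)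
      (fun w _ => sq_nonneg _) (Finset.mem_univ x)
    simpa using h1
  have ht' := mul_le_mul_of_nonneg_left ht hε.le
  unfold phi4SitePotential
  linarith

/-- **The lattice φ⁴ Schwinger–Dyson identity for a monomial, unnormalised**, under coercivity:
for every multi-index `k` and every site `x`,
`∫ (k_x Π_w φ_w^{k[x ↦ k_x−1]_w} − (Π_w φ_w^{k_w}) ∂S/∂φ_x) e^{−S(φ)} dφ = 0`. -/
theorem integral_sdIntegrand_eq_zero_of_coercive {J : Fin (n + 1) → Fin (n + 1) → ℝ}
    {lam ε K : ℝ} (hε : 0 < ε)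
    (hS : ∀ φ : Fin (n + 1) → ℝ, ε * ∑ w, φ w ^ 2 - K ≤ latticePhi4Action J lam φ)
    (k : Fin (n + 1) → ℕ) (x : Fin (n + 1)) :
    ∫ φ : Fin (n + 1) → ℝ, ((k x : ℝ) * (∏ w, φ w ^ Function.update k x (k x - 1) w)
        - (∏ w, φ w ^ k w) * latticePhi4Force J lam φ x) * gibbsWeight J lam φ = 0 := by
  set G : (Fin (n + 1) → ℝ) → ℝ :=
    fun φ => ((k x : ℝ) * (∏ w, φ w ^ Function.update k x (k x - 1) w)
        - (∏ w, φ w ^ k w) * latticePhi4Force J lam φ x) * gibbsWeight J lam φ with hG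
  have hGi : Integrable G := by
    have h1 := (integrable_monomial_mul_gibbsWeight_of_coercive hε hS
      (Function.update k x (k x - 1))).const_mul (k x : ℝ)
    have h2 := integrable_monomial_mul_force_mul_gibbsWeight_of_coercive hε hS k x
    refine (h1.sub h2).congr (Eventually.of_forall fun φ => ?_)
    simp only [Pi.sub_apply, hG]
    ring
  -- split off the `x`-th coordinate
  set e := MeasurableEquiv.piFinSuccAbove (fun _ : Fin (n + 1) => ℝ) x with he
  have hmp : MeasurePreserving e := volume_preserving_piFinSuccAbove (fun _ : Fin (n + 1) => ℝ) x
  have htrans : ∫ φ, G φ = ∫ x' : Fin n → ℝ, ∫ t : ℝ, G (Fin.insertNth x t x') := by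
    rw [← (hmp.symm e).integral_comp e.symm.measurableEmbedding]
    have hG' : Integrable (fun z : ℝ × (Fin n → ℝ) => G (e.symm z))
        ((volume : Measure ℝ).prod (volume : Measure (Fin n → ℝ))) :=
      (hmp.symm e).integrable_comp_emb e.symm.measurableEmbedding |>.2 hGi
    rw [show (volume : Measure (ℝ × (Fin n → ℝ))) = (volume : Measure ℝ).prod volume from rfl,
      integral_prod_symm _ hG']
    rfl
  change ∫ φ, G φ = 0
  rw [htrans]
  have hinner : ∀ x' : Fin n → ℝ, ∫ t : ℝ, G (Fin.insertNth x t x') = 0 := by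
    intro x'
    set ψ : Fin (n + 1) → ℝ := Fin.insertNth x (0 : ℝ) x' with hψ
    have hψx : ψ x = 0 := by simp [hψ]
    have hupd0 : Function.update ψ x 0 = ψ := by
      have h := Function.update_eq_self x ψ
      rwa [hψx] at h
    have hC : ∏ w ∈ univ.erase x, ψ w ^ Function.update k x (k x - 1) w
        = ∏ w ∈ univ.erase x, ψ w ^ k w :=
      Finset.prod_congr rfl fun w hw => by rw [Function.update_of_ne (ne_of_mem_erase hw)]
    have h0 := integral_phi4Site_sd_pow hε (sitePotential_coercive_of_coercive hε hS ψ x hψx) (k x)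
    have hpt : ∀ t : ℝ, G (Fin.insertNth x t x')
        = (∏ w ∈ univ.erase x, ψ w ^ k w) *
          ((((k x : ℕ) : ℝ) * t ^ (k x - 1)
              - t ^ (k x) * phi4SiteForce lam (J x x) (∑ y, (J x y + J y x) * ψ y) t)
            * phi4SiteWeight lam (J x x) (∑ y, (J x y + J y x) * ψ y)
                (latticePhi4Action J lam ψ) t) := by
      intro t
      have hins : Fin.insertNth x t x' = Function.update ψ x t := insertNth_eq_update x t x'
      rw [hins, hG]
      simp only []
      rw [prod_update_pow ψ x t k, prod_update_pow ψ x t (Function.update k x (k x - 1)), hC,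
        gibbsWeight, latticePhi4Action_update J lam ψ x t, hupd0,
        ← latticePhi4Force_eq J lam (Function.update ψ x t) x]
      simp only [Function.update_self, Function.update_idem, hupd0]
      simp only [phi4SiteForce, phi4SiteWeight, phi4SitePotential]
      ring
    simp only [hpt]
    rw [integral_const_mul, h0, mul_zero]
  simp only [hinner, integral_zero]

/-- **The lattice φ⁴ Schwinger–Dyson identity for every monomial observable, under coercivity**:
`⟨(Π_w φ_w^{k_w}) ∂S/∂φ_x⟩ = k_x ⟨Π_w φ_w^{k[x ↦ k_x − 1]_w}⟩` — `⟨f ∂S/∂φ_x⟩ = ⟨∂f/∂φ_x⟩` for the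
monomial `f = Π φ^k`, hence (linearity) for every polynomial `f`. -/
theorem gibbs_sd_monomial_of_coercive {J : Fin (n + 1) → Fin (n + 1) → ℝ} {lam ε K : ℝ}
    (hε : 0 < ε) (hS : ∀ φ : Fin (n + 1) → ℝ, ε * ∑ w, φ w ^ 2 - K ≤ latticePhi4Action J lam φ)
    (k : Fin (n + 1) → ℕ) (x : Fin (n + 1)) :
    gibbsExpect J lam (fun φ => (∏ w, φ w ^ k w) * latticePhi4Force J lam φ x)
      = k x * gibbsExpect J lam (fun φ => ∏ w, φ w ^ Function.update k x (k x - 1) w) := by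
  have h0 := integral_sdIntegrand_eq_zero_of_coercive hε hS k x
  have hA : Integrable (fun φ : Fin (n + 1) → ℝ =>
      (k x : ℝ) * ((∏ w, φ w ^ Function.update k x (k x - 1) w) * gibbsWeight J lam φ)) :=
    (integrable_monomial_mul_gibbsWeight_of_coercive hε hS _).const_mul _
  have hB := integrable_monomial_mul_force_mul_gibbsWeight_of_coercive hε hS k x
  have hsplit : ∫ φ : Fin (n + 1) → ℝ, ((k x : ℝ) * (∏ w, φ w ^ Function.update k x (k x - 1) w)
        - (∏ w, φ w ^ k w) * latticePhi4Force J lam φ x) * gibbsWeight J lam φ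
      = (∫ φ : Fin (n + 1) → ℝ,
          (k x : ℝ) * ((∏ w, φ w ^ Function.update k x (k x - 1) w) * gibbsWeight J lam φ))
        - ∫ φ : Fin (n + 1) → ℝ,
          (∏ w, φ w ^ k w) * latticePhi4Force J lam φ x * gibbsWeight J lam φ := by
    rw [← integral_sub hA hB]
    congr 1
    ext φ
    ring
  rw [hsplit, sub_eq_zero, integral_const_mul] at h0
  unfold gibbsExpect
  rw [← h0, mul_div_assoc]

/-! ## Discharging coercivity for `λ > 0` -/

/-- **For `λ > 0` the lattice action is coercive with `ε = 1`** (any real `J`): the companion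
file's `latticePhi4Action_ge`, `K = (n+1)(M+1)²/(4λ)`, `M = Σ|J_{yz}|`. -/
theorem latticePhi4Action_coercive {lam : ℝ} (hlam : 0 < lam)
    (J : Fin (n + 1) → Fin (n + 1) → ℝ) (φ : Fin (n + 1) → ℝ) :
    1 * ∑ w, φ w ^ 2 - (n + 1) * (((∑ y, ∑ z, |J y z|) + 1) ^ 2 / (4 * lam))
      ≤ latticePhi4Action J lam φ := by
  rw [one_mul]
  exact latticePhi4Action_ge hlam J φ

/-- All moments exist for `λ > 0`: `(Π_w φ_w^{k_w}) e^{−S}` is integrable, any real `J`. -/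
theorem integrable_monomial_mul_gibbsWeight {lam : ℝ} (hlam : 0 < lam)
    (J : Fin (n + 1) → Fin (n + 1) → ℝ) (k : Fin (n + 1) → ℕ) :
    Integrable (fun φ : Fin (n + 1) → ℝ => (∏ w, φ w ^ k w) * gibbsWeight J lam φ) :=
  integrable_monomial_mul_gibbsWeight_of_coercive one_pos (latticePhi4Action_coercive hlam J) k

/-- **The lattice φ⁴ Schwinger–Dyson identity for every monomial observable** under the Gibbs
measure `e^{−S} dφ / Z`, `S = Σ φJφ + λΣφ⁴` on `ℝ^{n+1}`, every `λ > 0`, every real `J` (incl.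
the tachyonic AKS 2019 sets): `⟨(Π_w φ_w^{k_w}) ∂S/∂φ_x⟩ = k_x ⟨Π_w φ_w^{k[x ↦ k_x − 1]_w}⟩`. -/
theorem gibbs_sd_monomial {lam : ℝ} (hlam : 0 < lam) (J : Fin (n + 1) → Fin (n + 1) → ℝ)
    (k : Fin (n + 1) → ℕ) (x : Fin (n + 1)) :
    gibbsExpect J lam (fun φ => (∏ w, φ w ^ k w) * latticePhi4Force J lam φ x)
      = k x * gibbsExpect J lam (fun φ => ∏ w, φ w ^ Function.update k x (k x - 1) w) :=
  gibbs_sd_monomial_of_coercive one_pos (latticePhi4Action_coercive hlam J) k x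

end Monomial

end Summit.Ventures.LatticeQCDFlow.Scoring
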